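import Mathlib
import Literature.Analysis.FluidPDE.TsaiMaximumPrinciple

/-!
# Route `FilamentSkeletonRss` · cruxes `TransverseReduction1AL` (stmt-NavierStokesRegularity-23297) / `TransverseReduction1AR` (stmt-23611) ·
# registered stub S2a-loc `WaistColumnGateLoc1A` — the AXIAL REDUCTION TOOL: a joint `(τ, u)` maximum principle with a slow penaliser

Helper file (theorems only, def-free; `--supports stmt-NavierStokesRegularity-23297 --as helper`; hand leafhand-ns-filamentskeletonrs-13 g0).

WHY.  The sectional bricks of the line (`maxPrinciple_of_wronskian` + `azimuthalBlock_apriori`, `radialBlock_apriori`, two-zone bounds; seats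
21221-p1 / s2aloc-p1) bound azimuthal vorticity profiles `w(u)` of perturbations that do NOT depend on the axial station `τ = ⟨y, d⟩`.  The
registered stub lets `W` depend on `τ` with no axial localisation; by `colForceVort_eq` the axial station enters only through `κτ∂_τ − ∂_τ²`
(`Theorems/…AxialNeutralModes.lean`, p827006: this one-variable operator has NO gap, so all coercivity must come from the section).  In the
modulus bookkeeping of the blocks the axial terms contribute `Re(w̄(κτ∂_τ − ∂_τ²)w) = ½(κτ∂_τ − ∂_τ²)|w|² + |∂_τ w|²`, which is `≥ −O(η)` at a
maximum point IN `τ` of the penalised quantity `v − η·p(τ)` (first/second order conditions `∂_τ v = η p′`, `∂_τ² v ≤ η p″`; with the slow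
penaliser `p = log(1 + log(1 + τ²))` one has `0 ≤ τ p′ ≤ 2`, `|p″| ≤ 4`, so `κτ·∂_τ v ≥ 0` and `−∂_τ² v ≥ −4η`).  This file supplies the
abstract principle that turns such a pointwise sign at a joint maximum into a global bound on the unbounded strip `ℝ × [α, β]`:

* `false_of_isMaxOn_of_wronskian` — the one-point core of the LEAD's `maxPrinciple_of_wronskian` (an interior maximum of `v` on `[α, β]` is
  incompatible with a Wronskian flux `Wr = P·v′`, `P > 0`, having a strictly positive derivative there);
* the second-order necessary condition `f″(x₀) ≤ 0` at a local maximum is the tree's `Literature.Analysis.FluidPDE.deriv_deriv_nonpos_of_isLocalMax`;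
* **`maxPrinciple_axial`** — `v : ℝ → ℝ → ℝ` (`τ`, `u`) jointly continuous on `ℝ × [α,β]`, bounded above, `C¹` in `u` on `(α,β)`, `C²` in `τ`;
  `v ≤ K` on `u ∈ {α, β}`; a penaliser `p ≥ 0`, `C²`, `p → +∞` as `|τ| → ∞`; and the ROBUST critical-point hypothesis: for every `η ∈ (0, η₀)`,
  at every interior point with `v > K`, `∂_u v = 0`, `∂_τ v = η p′(τ)`, `∂_τ² v ≤ η p″(τ)` the flux `Wr(τ, ·) = P·∂_u v` has a strictly positive
  `u`-derivative.  THEN `v ≤ K` on the whole strip.  (Penalise, maximise on a compact block outside which `v − ηp < K`, read off the three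
  conditions, contradict with the one-point core.)
HONEST FRAMING: elementary real analysis (a bookkeeping tool for ONE linear MODEL operator of a hypothetical filament-type blow-up route; MODEL rung,
negative side); `WaistColumnGateLoc1A`, `TransverseReduction1AL/1AR` are neither proved nor refuted; nothing here bears on Navier–Stokes regularity.
-/

set_option linter.dupNamespace false

noncomputable section

namespace Summit.NavierStokesRegularity.NavierStokesRegularity.Theorems.DefectColumnGate

open scoped Topology
open Set Filter

/-! ## 1. The one-point core of the Wronskian maximum principle -/

/-- **No interior maximum where the Wronskian flux increases.**  `v` continuous on `[α, β]` with derivative `v₁` on `(α, β)`, `Wr = P·v₁`,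
`P > 0` on `(α, β)`; if `ξ ∈ (α, β)` is a maximum point of `v` on `[α, β]` and `Wr` has a strictly positive derivative at `ξ`, contradiction.
(The argument of `maxPrinciple_of_wronskian`, `Theorems/…AzimuthalBlockPrelim.lean`, isolated at one point.) -/
theorem false_of_isMaxOn_of_wronskian {α β ξ D : ℝ} {v v₁ Wr P : ℝ → ℝ}
    (hv : ContinuousOn v (Icc α β))
    (hder : ∀ u ∈ Ioo α β, HasDerivAt v (v₁ u) u)
    (hWr : ∀ u ∈ Ioo α β, Wr u = P u * v₁ u)
    (hP : ∀ u ∈ Ioo α β, 0 < P u)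
    (hξ : ξ ∈ Ioo α β) (hmax : IsMaxOn v (Icc α β) ξ) (hD : 0 < D) (hWrD : HasDerivAt Wr D ξ) : False := by
  have hξα : α < ξ := hξ.1
  have hξβ : ξ < β := hξ.2
  -- first-order condition
  have hloc : IsLocalMax v ξ := hmax.isLocalMax (Icc_mem_nhds hξα hξβ)
  have hv₁ξ : v₁ ξ = 0 := hloc.hasDerivAt_eq_zero (hder ξ hξ)
  have hWrξ : Wr ξ = 0 := by rw [hWr ξ hξ, hv₁ξ, mul_zero]
  -- `Wr < 0` immediately to the left of `ξ`
  have ht : Tendsto (slope Wr ξ) (𝓝[<] ξ) (𝓝 D) :=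
    (hasDerivAt_iff_tendsto_slope.mp hWrD).mono_left (nhdsLT_le_nhdsNE ξ)
  have hev : ∀ᶠ c in 𝓝[<] ξ, 0 < slope Wr ξ c := ht.eventually_const_lt hD
  obtain ⟨l, hl, hlsub⟩ := mem_nhdsLT_iff_exists_Ioo_subset.mp hev
  have hneg : ∀ c ∈ Ioo l ξ, c ∈ Ioo α β → v₁ c < 0 := by
    intro c hc hcαβ
    have h1 : 0 < slope Wr ξ c := hlsub hc
    rw [slope_def_field, hWrξ, sub_zero] at h1
    have h2 : c - ξ < 0 := by linarith [hc.2]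
    have h3 : Wr c < 0 := by
      by_contra h4
      have h4' : 0 ≤ Wr c := not_lt.mp h4
      have : Wr c / (c - ξ) ≤ 0 := div_nonpos_of_nonneg_of_nonpos h4' h2.le
      linarith
    rw [hWr c hcαβ] at h3
    by_contra h5
    have h5' : 0 ≤ v₁ c := not_lt.mp h5
    have : 0 ≤ P c * v₁ c := mul_nonneg (hP c hcαβ).le h5'
    linarith
  -- a point `u₁` to the left of `ξ`, inside `(α, β)` and inside `(l, ξ)`
  set u₁ : ℝ := (max l α + ξ) / 2 with hu₁def
  have hu₁l : l < u₁ := by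
    have := le_max_left l α
    have := mem_Iio.mp hl
    rw [hu₁def]; linarith
  have hu₁α : α < u₁ := by
    have := le_max_right l α
    have := mem_Iio.mp hl
    rw [hu₁def]; linarith
  have hu₁ξ : u₁ < ξ := by
    have := max_lt (mem_Iio.mp hl) hξα
    rw [hu₁def]; linarith
  -- mean value theorem on `[u₁, ξ]`
  have hcont : ContinuousOn v (Icc u₁ ξ) := hv.mono (Icc_subset_Icc hu₁α.le hξβ.le)
  have hdiff : ∀ x ∈ Ioo u₁ ξ, HasDerivAt v (v₁ x) x :=
    fun x hx => hder x ⟨lt_trans hu₁α hx.1, lt_trans hx.2 hξβ⟩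
  obtain ⟨c, hc, hcslope⟩ := exists_hasDerivAt_eq_slope v v₁ hu₁ξ hcont hdiff
  have hcneg : v₁ c < 0 :=
    hneg c ⟨lt_trans hu₁l hc.1, hc.2⟩ ⟨lt_trans hu₁α hc.1, lt_trans hc.2 hξβ⟩
  rw [hcslope] at hcneg
  have hlt : v ξ < v u₁ := by
    have hpos : 0 < ξ - u₁ := by linarith
    rcases div_neg_iff.mp hcneg with ⟨h1, _⟩ | ⟨_, h2⟩
    · linarith
    · linarith
  have hle : v u₁ ≤ v ξ := hmax ⟨hu₁α.le, (lt_trans hu₁ξ hξβ).le⟩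
  linarith

/-! ## 2. The joint `(τ, u)` maximum principle with a slow penaliser -/

/-- **AXIAL MAXIMUM PRINCIPLE.**  Data: `v : ℝ → ℝ → ℝ` (axial station `τ`, sectional variable `u`) jointly continuous on `ℝ × [α, β]` and bounded
above there; `u`-derivative `v_u` on `(α, β)` for every `τ`; `τ`-derivatives `v_τ`, `v_ττ` at every `τ` for every interior `u`; a Wronskian flux
`Wr(τ, ·) = P(τ, ·)·v_u(τ, ·)` with `P > 0`; boundary values `v(τ, α), v(τ, β) ≤ K`; a penaliser `p ≥ 0` with derivatives `p₁`, `p₂` and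
`p → +∞` along `cocompact ℝ`.  ROBUST CRITICAL-POINT HYPOTHESIS: for every `η ∈ (0, η₀)`, at every interior point where `v > K`, `v_u = 0`,
`v_τ = η·p₁(τ)` and `v_ττ ≤ η·p₂(τ)`, the flux `Wr(τ, ·)` has a strictly positive derivative.  CONCLUSION: `v ≤ K` on `ℝ × [α, β]`. -/
theorem maxPrinciple_axial {α β K η₀ : ℝ} {v v_u v_τ v_ττ Wr P : ℝ → ℝ → ℝ} {p p₁ p₂ : ℝ → ℝ}
    (hη₀ : 0 < η₀)
    (hcont : ContinuousOn (fun q : ℝ × ℝ => v q.1 q.2) (univ ×ˢ Icc α β))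
    (hbdd : ∃ B : ℝ, ∀ τ, ∀ u ∈ Icc α β, v τ u ≤ B)
    (hder_u : ∀ τ, ∀ u ∈ Ioo α β, HasDerivAt (v τ) (v_u τ u) u)
    (hder_τ : ∀ u ∈ Ioo α β, ∀ τ, HasDerivAt (fun σ => v σ u) (v_τ τ u) τ)
    (hder_ττ : ∀ u ∈ Ioo α β, ∀ τ, HasDerivAt (fun σ => v_τ σ u) (v_ττ τ u) τ)
    (hWr : ∀ τ, ∀ u ∈ Ioo α β, Wr τ u = P τ u * v_u τ u)
    (hP : ∀ τ, ∀ u ∈ Ioo α β, 0 < P τ u)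
    (hp : ∀ τ, HasDerivAt p (p₁ τ) τ) (hp₁ : ∀ τ, HasDerivAt p₁ (p₂ τ) τ) (hp0 : ∀ τ, 0 ≤ p τ)
    (hpinf : Tendsto p (cocompact ℝ) atTop)
    (hcrit : ∀ η : ℝ, 0 < η → η < η₀ → ∀ τ, ∀ u ∈ Ioo α β, K < v τ u → v_u τ u = 0 → v_τ τ u = η * p₁ τ → v_ττ τ u ≤ η * p₂ τ →
      ∃ D : ℝ, 0 < D ∧ HasDerivAt (Wr τ) D u)
    (hbα : ∀ τ, v τ α ≤ K) (hbβ : ∀ τ, v τ β ≤ K) :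
    ∀ τ, ∀ u ∈ Icc α β, v τ u ≤ K := by
  by_contra hcon
  simp only [not_forall, not_le, exists_prop] at hcon
  obtain ⟨τ₀, u₀, hu₀, hK⟩ := hcon
  obtain ⟨B, hB⟩ := hbdd
  -- the penalisation parameter
  set η : ℝ := min (η₀ / 2) ((v τ₀ u₀ - K) / (2 * (p τ₀ + 1))) with hηdef
  have hgap : 0 < v τ₀ u₀ - K := by linarith
  have hp1 : 0 < p τ₀ + 1 := by linarith [hp0 τ₀]
  have hη0 : 0 < η := lt_min (by linarith) (div_pos hgap (by positivity))
  have hηη₀ : η < η₀ := lt_of_le_of_lt (min_le_left _ _) (by linarith)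
  have hηp : η * p τ₀ < v τ₀ u₀ - K := by
    have h1 : η ≤ (v τ₀ u₀ - K) / (2 * (p τ₀ + 1)) := min_le_right _ _
    have h2 : η * p τ₀ ≤ (v τ₀ u₀ - K) / (2 * (p τ₀ + 1)) * p τ₀ := mul_le_mul_of_nonneg_right h1 (hp0 τ₀)
    have h3 : (v τ₀ u₀ - K) / (2 * (p τ₀ + 1)) * p τ₀ ≤ (v τ₀ u₀ - K) / 2 := by
      rw [div_mul_eq_mul_div, div_le_div_iff₀ (by positivity) (by norm_num)]
      nlinarith [hp0 τ₀]
    linarith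
  -- the penalised function
  set g : ℝ × ℝ → ℝ := fun q => v q.1 q.2 - η * p q.1 with hgdef
  have hpc : Continuous p := continuous_iff_continuousAt.2 fun τ => (hp τ).continuousAt
  -- a compact block outside which `g < K`
  have hev : ∀ᶠ τ in cocompact ℝ, (B - K) / η + 1 ≤ p τ := hpinf.eventually (eventually_ge_atTop _)
  rw [cocompact_eq_atBot_atTop, eventually_sup, eventually_atBot, eventually_atTop] at hev
  obtain ⟨⟨T₁, hT₁⟩, ⟨T₂, hT₂⟩⟩ := hev
  have hout : ∀ τ, (B - K) / η + 1 ≤ p τ → ∀ u ∈ Icc α β, g (τ, u) < K := by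
    intro τ hτ u hu
    have h1 : v τ u ≤ B := hB τ u hu
    have h2 : (B - K) + η ≤ η * p τ := by
      have := mul_le_mul_of_nonneg_left hτ hη0.le
      rwa [mul_add, mul_one, mul_div_cancel₀ _ hη0.ne'] at this
    show v τ u - η * p τ < K
    linarith
  set S : Set ℝ := Icc (min T₁ τ₀) (max T₂ τ₀) with hSdef
  have hτ₀S : τ₀ ∈ S := ⟨min_le_right _ _, le_max_right _ _⟩
  have hSout : ∀ τ, τ ∉ S → ∀ u ∈ Icc α β, g (τ, u) < K := by
    intro τ hτ u hu
    rw [hSdef, mem_Icc, not_and_or, not_le, not_le] at hτ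
    rcases hτ with hτ | hτ
    · exact hout τ (hT₁ τ (by linarith [min_le_left T₁ τ₀])) u hu
    · exact hout τ (hT₂ τ (by linarith [le_max_left T₂ τ₀])) u hu
  -- maximise `g` on the compact block
  have hcomp : IsCompact (S ×ˢ Icc α β) := isCompact_Icc.prod isCompact_Icc
  have hne : (S ×ˢ Icc α β).Nonempty := ⟨(τ₀, u₀), ⟨hτ₀S, hu₀⟩⟩
  have hgc : ContinuousOn g (S ×ˢ Icc α β) := by
    have h1 : ContinuousOn (fun q : ℝ × ℝ => v q.1 q.2) (S ×ˢ Icc α β) :=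
      hcont.mono (prod_mono (subset_univ _) subset_rfl)
    have h2 : ContinuousOn (fun q : ℝ × ℝ => η * p q.1) (S ×ˢ Icc α β) :=
      ((hpc.comp continuous_fst).const_smul η).continuousOn.congr (fun q _ => by simp [smul_eq_mul])
    exact h1.sub h2
  obtain ⟨qs, hqs, hmax⟩ := hcomp.exists_isMaxOn hne hgc
  obtain ⟨τs, us⟩ := qs
  have hτsS : τs ∈ S := hqs.1
  have husI : us ∈ Icc α β := hqs.2
  -- values at the maximum
  have hg0 : K < g (τ₀, u₀) := by show K < v τ₀ u₀ - η * p τ₀; linarith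
  have hgmax : g (τ₀, u₀) ≤ g (τs, us) := hmax ⟨hτ₀S, hu₀⟩
  have hgs : K < g (τs, us) := lt_of_lt_of_le hg0 hgmax
  have hvs : K < v τs us := by
    have : g (τs, us) = v τs us - η * p τs := rfl
    have := hp0 τs
    nlinarith
  -- `us` is interior
  have husα : us ≠ α := fun h => by rw [h] at hvs; exact absurd (hbα τs) (not_le.mpr hvs)
  have husβ : us ≠ β := fun h => by rw [h] at hvs; exact absurd (hbβ τs) (not_le.mpr hvs)
  have hus : us ∈ Ioo α β := ⟨lt_of_le_of_ne husI.1 (Ne.symm husα), lt_of_le_of_ne husI.2 husβ⟩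
  -- `τs` is a global maximum of `τ ↦ g(τ, us)` on `ℝ`
  have hτmax : ∀ τ, g (τ, us) ≤ g (τs, us) := by
    intro τ
    by_cases hτ : τ ∈ S
    · exact hmax ⟨hτ, husI⟩
    · exact (hSout τ hτ us husI).le.trans hgs.le
  -- first- and second-order conditions in `τ`
  set G : ℝ → ℝ := fun τ => v τ us - η * p τ with hGdef
  have hGeq : ∀ τ, G τ = g (τ, us) := fun τ => rfl
  have hGloc : IsLocalMax G τs := Filter.Eventually.of_forall fun τ => by rw [hGeq, hGeq]; exact hτmax τ
  have hGder : ∀ τ, HasDerivAt G (v_τ τ us - η * p₁ τ) τ := fun τ => (hder_τ us hus τ).sub ((hp τ).const_mul η)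
  have hGderiv : deriv G = fun τ => v_τ τ us - η * p₁ τ := funext fun τ => (hGder τ).deriv
  have hfirst : v_τ τs us = η * p₁ τs := by
    have h := hGloc.hasDerivAt_eq_zero (hGder τs)
    linarith
  have hsecond : v_ττ τs us ≤ η * p₂ τs := by
    have h := Literature.Analysis.FluidPDE.deriv_deriv_nonpos_of_isLocalMax hGloc (hGder τs).continuousAt
    have hd2 : HasDerivAt (deriv G) (v_ττ τs us - η * p₂ τs) τs := by
      rw [hGderiv]; exact (hder_ττ us hus τs).sub ((hp₁ τs).const_mul η)
    rw [hd2.deriv] at h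
    linarith
  -- first-order condition in `u`: `us` maximises `v(τs, ·)` on `[α, β]`
  have humax : IsMaxOn (v τs) (Icc α β) us := by
    intro u hu
    have hgu : g (τs, u) ≤ g (τs, us) := hmax (show ((τs, u) : ℝ × ℝ) ∈ S ×ˢ Icc α β from ⟨hτsS, hu⟩)
    show v τs u ≤ v τs us
    have e1 : g (τs, u) = v τs u - η * p τs := rfl
    have e2 : g (τs, us) = v τs us - η * p τs := rfl
    linarith
  have huloc : IsLocalMax (v τs) us := humax.isLocalMax (Icc_mem_nhds hus.1 hus.2)
  have hvu0 : v_u τs us = 0 := huloc.hasDerivAt_eq_zero (hder_u τs us hus)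
  -- the robust hypothesis fires; contradiction with the one-point core
  obtain ⟨D, hD, hWrD⟩ := hcrit η hη0 hηη₀ τs us hus hvs hvu0 hfirst hsecond
  have hvc : ContinuousOn (v τs) (Icc α β) := by
    have hι : ContinuousOn (fun u : ℝ => ((τs, u) : ℝ × ℝ)) (Icc α β) := (Continuous.prodMk_right τs).continuousOn
    exact hcont.comp hι (fun u hu => ⟨mem_univ _, hu⟩)
  exact false_of_isMaxOn_of_wronskian hvc (hder_u τs) (hWr τs) (hP τs) hus humax hD hWrD


/-! ## 3. A turnkey slow penaliser and the specialised principle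

The axial transport is `κτ∂_τ` (dilation-type), so the penaliser must be slow on the LOG-LOG scale: `p(τ) = log(1 + log(1 + τ²))` has
`0 ≤ τ·p′(τ) ≤ 2`, `|p′| ≤ 1`, `|p″| ≤ 10` and `p → +∞`.  With it the robust hypothesis of `maxPrinciple_axial` only has to tolerate, at the
critical point, `0 ≤ τ·∂_τ v ≤ δ`, `|∂_τ v| ≤ δ` and `∂_τ² v ≤ δ` for ONE `δ > 0` of the user's choosing (`maxPrinciple_axial_slow`): in the modulus
bookkeeping of the blocks the axial contribution `½(κτ∂_τ − ∂_τ²)|w|²` at such a point is `≥ −δ/2`, and `κτ∂_τ|w|² ≥ 0` even has the good sign. -/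

/-- **A slow penaliser**: `p = log(1 + log(1 + τ²))` with its first two derivatives and the bounds `p ≥ 0`, `0 ≤ τ p′ ≤ 2`, `|p′| ≤ 1`,
`|p″| ≤ 10`, `p → +∞` along `cocompact ℝ` (stated as an existence result to keep the file definition-free). -/
theorem exists_slow_penaliser :
    ∃ p p₁ p₂ : ℝ → ℝ, (∀ τ, HasDerivAt p (p₁ τ) τ) ∧ (∀ τ, HasDerivAt p₁ (p₂ τ) τ) ∧ (∀ τ, 0 ≤ p τ) ∧
      Tendsto p (cocompact ℝ) atTop ∧ (∀ τ, 0 ≤ τ * p₁ τ) ∧ (∀ τ, τ * p₁ τ ≤ 2) ∧ (∀ τ, |p₁ τ| ≤ 1) ∧ (∀ τ, |p₂ τ| ≤ 10) := by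
  set L : ℝ → ℝ := fun τ => Real.log (1 + τ ^ 2) with hLdef
  have hq : ∀ τ : ℝ, 0 < 1 + τ ^ 2 := fun τ => by positivity
  have hL0 : ∀ τ, 0 ≤ L τ := fun τ => Real.log_nonneg (by nlinarith [sq_nonneg τ])
  have hM : ∀ τ, 0 < 1 + L τ := fun τ => by linarith [hL0 τ]
  have hD : ∀ τ, 0 < (1 + τ ^ 2) * (1 + L τ) := fun τ => mul_pos (hq τ) (hM τ)
  have hD1 : ∀ τ, 1 ≤ (1 + τ ^ 2) * (1 + L τ) := fun τ => by nlinarith [hL0 τ, sq_nonneg τ]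
  -- derivatives
  have h1 : ∀ τ : ℝ, HasDerivAt (fun x : ℝ => 1 + x ^ 2) (2 * τ) τ := by
    intro τ
    have h := (hasDerivAt_pow 2 τ).const_add 1
    simpa using h
  have hLd : ∀ τ, HasDerivAt L (2 * τ / (1 + τ ^ 2)) τ := fun τ => (h1 τ).log (hq τ).ne'
  refine ⟨fun τ => Real.log (1 + L τ), fun τ => 2 * τ / ((1 + τ ^ 2) * (1 + L τ)),
    fun τ => (2 * (1 + τ ^ 2) * (1 + L τ) - 2 * τ * (2 * τ * (1 + L τ) + 2 * τ)) / ((1 + τ ^ 2) * (1 + L τ)) ^ 2,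
    fun τ => ?_, fun τ => ?_, fun τ => Real.log_nonneg (by linarith [hL0 τ]), ?_, fun τ => ?_, fun τ => ?_, fun τ => ?_, fun τ => ?_⟩
  · -- `p′`
    have h := ((hLd τ).const_add 1).log (hM τ).ne'
    refine h.congr_deriv ?_
    rw [div_div]
  · -- `p″`
    have hN : HasDerivAt (fun x : ℝ => 2 * x) 2 τ := by simpa using (hasDerivAt_id τ).const_mul (2:ℝ)
    have hDd : HasDerivAt (fun x : ℝ => (1 + x ^ 2) * (1 + L x)) (2 * τ * (1 + L τ) + (1 + τ ^ 2) * (2 * τ / (1 + τ ^ 2))) τ :=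
      (h1 τ).mul ((hLd τ).const_add 1)
    have h := hN.div hDd (hD τ).ne'
    refine h.congr_deriv ?_
    have hq' : (1 + τ ^ 2) ≠ 0 := (hq τ).ne'
    field_simp
  · -- `p → +∞`
    have t1 : Tendsto (fun τ : ℝ => τ ^ 2) (cocompact ℝ) atTop := by
      have h := (tendsto_pow_atTop (α := ℝ) (n := 2) (by norm_num)).comp (tendsto_norm_cocompact_atTop (E := ℝ))
      refine h.congr fun τ => ?_
      simp [Real.norm_eq_abs, sq_abs]
    have t2 : Tendsto (fun τ : ℝ => 1 + τ ^ 2) (cocompact ℝ) atTop := tendsto_atTop_add_const_left _ 1 t1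
    have t3 : Tendsto L (cocompact ℝ) atTop := Real.tendsto_log_atTop.comp t2
    have t4 : Tendsto (fun τ => 1 + L τ) (cocompact ℝ) atTop := tendsto_atTop_add_const_left _ 1 t3
    exact Real.tendsto_log_atTop.comp t4
  · -- `0 ≤ τ p′`
    rw [mul_div_assoc', show τ * (2 * τ) = 2 * τ ^ 2 by ring]
    exact div_nonneg (by positivity) (hD τ).le
  · -- `τ p′ ≤ 2`
    rw [mul_div_assoc', show τ * (2 * τ) = 2 * τ ^ 2 by ring, div_le_iff₀ (hD τ)]
    nlinarith [hL0 τ, sq_nonneg τ]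
  · -- `|p′| ≤ 1`
    rw [abs_div, abs_of_pos (hD τ), div_le_one (hD τ), abs_mul, abs_two]
    have h2 : 2 * |τ| ≤ 1 + τ ^ 2 := by nlinarith [sq_nonneg (|τ| - 1), sq_abs τ]
    nlinarith [hL0 τ, h2, abs_nonneg τ]
  · -- `|p″| ≤ 10`
    rw [abs_div, abs_of_pos (pow_pos (hD τ) 2), div_le_iff₀ (pow_pos (hD τ) 2)]
    have hτ2 : τ ^ 2 ≤ 1 + τ ^ 2 := by linarith
    have hnum : |2 * (1 + τ ^ 2) * (1 + L τ) - 2 * τ * (2 * τ * (1 + L τ) + 2 * τ)| ≤ 10 * ((1 + τ ^ 2) * (1 + L τ)) := by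
      rw [abs_le]
      constructor
      · nlinarith [hL0 τ, sq_nonneg τ, mul_nonneg (sq_nonneg τ) (hL0 τ)]
      · nlinarith [hL0 τ, sq_nonneg τ, mul_nonneg (sq_nonneg τ) (hL0 τ)]
    calc |2 * (1 + τ ^ 2) * (1 + L τ) - 2 * τ * (2 * τ * (1 + L τ) + 2 * τ)| ≤ 10 * ((1 + τ ^ 2) * (1 + L τ)) := hnum
      _ ≤ 10 * ((1 + τ ^ 2) * (1 + L τ)) ^ 2 := by nlinarith [hD1 τ, hD τ]

/-- **AXIAL MAXIMUM PRINCIPLE, turnkey form.**  As `maxPrinciple_axial`, with the penaliser chosen (`exists_slow_penaliser`): it suffices that for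
SOME `δ > 0`, at every interior point with `v > K`, `v_u = 0`, `0 ≤ τ·v_τ ≤ δ`, `|v_τ| ≤ δ`, `v_ττ ≤ δ` the Wronskian flux `Wr(τ, ·)` has a strictly
positive `u`-derivative. -/
theorem maxPrinciple_axial_slow {α β K δ : ℝ} {v v_u v_τ v_ττ Wr P : ℝ → ℝ → ℝ}
    (hδ : 0 < δ)
    (hcont : ContinuousOn (fun q : ℝ × ℝ => v q.1 q.2) (univ ×ˢ Icc α β))
    (hbdd : ∃ B : ℝ, ∀ τ, ∀ u ∈ Icc α β, v τ u ≤ B)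
    (hder_u : ∀ τ, ∀ u ∈ Ioo α β, HasDerivAt (v τ) (v_u τ u) u)
    (hder_τ : ∀ u ∈ Ioo α β, ∀ τ, HasDerivAt (fun σ => v σ u) (v_τ τ u) τ)
    (hder_ττ : ∀ u ∈ Ioo α β, ∀ τ, HasDerivAt (fun σ => v_τ σ u) (v_ττ τ u) τ)
    (hWr : ∀ τ, ∀ u ∈ Ioo α β, Wr τ u = P τ u * v_u τ u)
    (hP : ∀ τ, ∀ u ∈ Ioo α β, 0 < P τ u)
    (hcrit : ∀ τ, ∀ u ∈ Ioo α β, K < v τ u → v_u τ u = 0 → 0 ≤ τ * v_τ τ u → τ * v_τ τ u ≤ δ → |v_τ τ u| ≤ δ → v_ττ τ u ≤ δ →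
      ∃ D : ℝ, 0 < D ∧ HasDerivAt (Wr τ) D u)
    (hbα : ∀ τ, v τ α ≤ K) (hbβ : ∀ τ, v τ β ≤ K) :
    ∀ τ, ∀ u ∈ Icc α β, v τ u ≤ K := by
  obtain ⟨p, p₁, p₂, hp, hp₁, hp0, hpinf, hτp0, hτp2, hp1, hp10⟩ := exists_slow_penaliser
  refine maxPrinciple_axial (η₀ := δ / 10) (by positivity) hcont hbdd hder_u hder_τ hder_ττ hWr hP hp hp₁ hp0 hpinf ?_ hbα hbβ
  intro η hη hη₀ τ u hu hK hvu hvτ hvττ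
  refine hcrit τ u hu hK hvu ?_ ?_ ?_ ?_
  · rw [hvτ, mul_left_comm]; exact mul_nonneg hη.le (hτp0 τ)
  · rw [hvτ, mul_left_comm]
    have := mul_le_mul_of_nonneg_left (hτp2 τ) hη.le
    linarith
  · rw [hvτ, abs_mul, abs_of_pos hη]
    have := mul_le_mul_of_nonneg_left (hp1 τ) hη.le
    linarith
  · have h1 : p₂ τ ≤ 10 := le_trans (le_abs_self _) (hp10 τ)
    have := mul_le_mul_of_nonneg_left h1 hη.le
    linarith


/-! ## 4. The axial modulus identity (how the axial terms enter the blocks' flux bookkeeping)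

For a complex profile `w = a + ib` along the axis and `s = |w|² = a² + b²`:
`Re( w̄·(κτ∂_τ − ∂_τ²) w ) = a(κτa′ − a″) + b(κτb′ − b″) = ½(κτ s′ − s″) + (a′² + b′²)`.
So at a penalised joint maximum (`0 ≤ τ·∂_τ v`, `∂_τ² v ≤ δ`, `v = ψ(u)·s` with `ψ(u) > 0` fixed) the axial terms, moved to the data side of the
sectional block, contribute `≥ −δ/(2ψ(u))`: the transport part has the good sign and only the (dilated-away) diffusion part costs `δ`. -/

/-- **Axial modulus identity.**  With `s = a² + b²`: the first two `τ`-derivatives of `s` and the identity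
`a(κτa₁ − a₂) + b(κτb₁ − b₂) = ½(κτ s₁ − s₂) + (a₁² + b₁²)`. -/
theorem axial_modulus_identity {a b a₁ b₁ a₂ b₂ : ℝ → ℝ} {τ : ℝ} (κ : ℝ)
    (ha : ∀ σ, HasDerivAt a (a₁ σ) σ) (hb : ∀ σ, HasDerivAt b (b₁ σ) σ)
    (ha₁ : HasDerivAt a₁ (a₂ τ) τ) (hb₁ : HasDerivAt b₁ (b₂ τ) τ) :
    HasDerivAt (fun σ => a σ ^ 2 + b σ ^ 2) (2 * (a τ * a₁ τ + b τ * b₁ τ)) τ ∧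
    HasDerivAt (fun σ => 2 * (a σ * a₁ σ + b σ * b₁ σ)) (2 * (a₁ τ ^ 2 + a τ * a₂ τ + b₁ τ ^ 2 + b τ * b₂ τ)) τ ∧
    a τ * (κ * τ * a₁ τ - a₂ τ) + b τ * (κ * τ * b₁ τ - b₂ τ)
      = (κ * τ * (2 * (a τ * a₁ τ + b τ * b₁ τ)) - 2 * (a₁ τ ^ 2 + a τ * a₂ τ + b₁ τ ^ 2 + b τ * b₂ τ)) / 2
        + (a₁ τ ^ 2 + b₁ τ ^ 2) := by
  refine ⟨?_, ?_, by ring⟩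
  · have h := ((ha τ).pow 2).add ((hb τ).pow 2)
    refine h.congr_deriv ?_
    simp only [Nat.cast_ofNat]
    ring
  · have h := (((ha τ).mul (ha₁)).add ((hb τ).mul hb₁)).const_mul 2
    refine h.congr_deriv ?_
    ring

/-- **Axial modulus lower bound at a penalised critical point.**  If `τ·s₁ ≥ 0` and `s₂ ≤ δ'` (the first/second-order conditions in `τ`
delivered by `maxPrinciple_axial_slow` for `v = ψ·s`, divided by the positive constant `ψ`), and `κ ≥ 0`, then
`a(κτa₁ − a₂) + b(κτb₁ − b₂) ≥ −δ'/2`. -/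
theorem axial_modulus_lower {a b a₁ b₁ a₂ b₂ s₁ s₂ κ τ δ' : ℝ}
    (hs₁ : s₁ = 2 * (a * a₁ + b * b₁)) (hs₂ : s₂ = 2 * (a₁ ^ 2 + a * a₂ + b₁ ^ 2 + b * b₂))
    (hκ : 0 ≤ κ) (hτs : 0 ≤ τ * s₁) (hs₂δ : s₂ ≤ δ') :
    -(δ' / 2) ≤ a * (κ * τ * a₁ - a₂) + b * (κ * τ * b₁ - b₂) := by
  have e : a * (κ * τ * a₁ - a₂) + b * (κ * τ * b₁ - b₂) = (κ * (τ * s₁) - s₂) / 2 + (a₁ ^ 2 + b₁ ^ 2) := by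
    rw [hs₁, hs₂]; ring
  rw [e]
  have h1 : 0 ≤ κ * (τ * s₁) := mul_nonneg hκ hτs
  nlinarith [sq_nonneg a₁, sq_nonneg b₁]

end Summit.NavierStokesRegularity.NavierStokesRegularity.Theorems.DefectColumnGate

end
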